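import Literature.AlgebraicGeometry.Resolution.HuGammaSchemePresentation
import HarnessLib

/-!
# Hu's terms, `𝔯`-variables, governing binomials and linearized Plücker relations (Hu 2025, §4.1, Def. 4.47–4.51)

Topic: `Literature/AlgebraicGeometry/Resolution`. Continuation of `HuGammaSchemePresentation.lean`
(Hu's Plücker variables `HuVar m` on the chart `p₁₂₃ ≠ 0` of `Gr(3, m+3)`, the primary relations
`primaryRel` (3.5) indexed by their leading variables `LeadVar m`, and `x_u ↦ minor_u`). Y. Hu,
*Universal characteristic-free resolution of singularities, I* (arXiv:2507.21400) separates the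
terms of every primary relation `F̄ = x_{u_F} + Σ_{s ∈ S_F ∖ s_F} sgn(s) x_{u_s} x_{v_s}` by passing
to `𝓡 = 𝕌 × ∏_F ℙ_F`, `ℙ_F` with homogeneous coordinates `[x_{(u_s,v_s)}]_{s ∈ S_F}` (§4.1), and
the degree-two homomorphism (Def. 4.2)

  `φ : R = R₀[x_{(u_s,v_s)}] → R₀ = k[x_u]`, `φ|_{R₀} = id`, `x_{(u_s,v_s)} ↦ x_{u_s} x_{v_s}`,

whose multi-homogeneous kernel cuts out the model `𝒱` (Lemma 4.3, Cor. 4.46). The relations the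
blow-ups are designed on are (Def. 4.47–4.51, (4.34)–(4.35)):

> "`B_{F,s} : x_{(u_s,v_s)} x_{u_F} - x_{(𝔪,u_F)} x_{u_s} x_{v_s}`, `s ∈ S_F ∖ s_F`" (governing),
> "`B_{F,(s,t)}`" (non-governing; the `℘`-binomials `x_{u'}x_{v'}x_{(u,v)} - x_u x_v x_{(u',v')}`,
> (4.30)), and "`L_F = Σ_{s ∈ S_F} sgn(s) x_{(u_s,v_s)}`" (linearized Plücker, (4.27)/(2.14)),
> with "`dim (∏_F ℙ_F) = Σ_F |S_F ∖ s_F| = |𝓑^gov|`" (4.37).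

This file renders this combinatorics in the `[I₃ | A]`-anchored coordinates of the tree and PROVES
the identities that are actually used downstream (everything is definitional bookkeeping plus
polynomial identities; no named facts, D-0026):

* `HuTerm m` — the non-leading terms `s ∈ S_F ∖ s_F` (two per rank-0 relation, three per rank-1
  relation; this type also indexes `𝓑^gov` and the non-leading `𝔯`-variables, which is (4.37));
  `HuTerm.rel/fst/snd/sign` — the relation `F` of `s`, the pair `(u_s, v_s)` and `sgn(s)`, read
  off (3.5); `primaryRel_eq_rank0/rank1` — **(3.5) re-assembled from its terms**:
  `F̄ = x_{u_F} + Σ_s sgn(s) x_{u_s} x_{v_s}`;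
* `HuRVar m = LeadVar m ⊕ HuTerm m` — the `𝔯`-variables (the leading one `x_{(𝔪,u_F)}` of each
  `ℙ_F`, Def. 4.47, and the `x_{(u_s,v_s)}`), `HuRing R m = R[x_u, x_{(u,v)}]` — Hu's `R` (Def. 4.2),
  and `huPhi` — **`φ`**;
* `govBinomial s` — **`B_{F,s}` verbatim**, `ngvBinomial s t` — **`B_{F,(s,t)}`**, `linPl F` —
  **`L_F`**; `huPhi_govBinomial`, `huPhi_ngvBinomial` (`= 0`: they lie in `ker φ`, Lemma 4.4),
  `huPhi_linPl` (**`φ(L_F) = F̄`**), hence `plEval_huPhi_linPl` (`L_F` dies on the graph of the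
  `[I₃ | A]` model) — the containments `𝒱 ⊆ V(𝓑^gov, 𝓑^ngv, L_𝓕)` at the level of coordinate rings;
* `X_rlead_mul_primaryRel_sub_mem` — the printed reduction (4.33):
  **`x_{(𝔪,u_F)} · F̄ - x_{u_F} · L_F = -Σ_s sgn(s) B_{F,s}`** lies in the ideal of the governing
  binomials of `F` ("`F̄_i` depends on `L_{F_i}` modulo `𝓑^℘`").

Two misprints of the source are corrected by construction (the data come from (3.5)): in the
display after Def. 4.49 (and in (2.11)) the sixth governing binomial must read
`x_{3uv}x_{(23u,13v)} - x_{23u}x_{13v}x_{(123,3uv)}` (printed `x_{12v}`), and `B_{F,(s,t)}` is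
`x_{(u_s,v_s)}x_{u_t}x_{v_t} - x_{(u_t,v_t)}x_{u_s}x_{v_s}` as in Lemma 7.3 (the display (4.35) has a
spurious extra factor `x_{u_t}`).

## References

* Y. Hu, *Universal Characteristic-free Resolution of Singularities, I*, arXiv:2507.21400 (2025),
  §3.5 (3.5), §4.1 (Def. 4.1–4.2, Lemma 4.3–4.4), §4.4 (4.27)–(4.33), Cor. 4.46, §4.5
  Def. 4.47–4.51, (4.34)–(4.37) (theorem numbers of the arXiv v1 TeX source). [Hu2025]
-/

noncomputable section

open MvPolynomial

namespace Literature.AlgebraicGeometry.Resolution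

universe u

/-! ### The non-leading terms `S_F ∖ s_F` and their data `(u_s, v_s)`, `sgn(s)` -/

/-- **The non-leading terms** `s ∈ S_F ∖ s_F` of the primary relations: two for each rank-0
relation `F̄_{(123),(k+1)ab}` and three for each rank-1 relation `F̄_{(123),abc}` (3.5). The same
type indexes the governing binomials `𝓑^gov = {B_{F,s}}` and the non-leading `𝔯`-variables
`x_{(u_s,v_s)}` — Hu's identity (4.37) `dim ∏_F ℙ_F = Σ_F |S_F ∖ s_F| = |𝓑^gov|`.
[cite: Hu2025, §3.5 (3.5) and §4.5 (4.37)] -/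
abbrev HuTerm (m : ℕ) : Type := (Fin 3 × HuPair m × Fin 2) ⊕ (HuTripleIdx m × Fin 3)

namespace HuTerm

variable {m : ℕ}

/-- The relation `F ∈ 𝓕` (named by its leading variable) to which the term belongs. [cite: Hu2025, §3.5 (3.5)] -/
def rel : HuTerm m → LeadVar m
  | Sum.inl (k, p, _) => Sum.inl (k, p)
  | Sum.inr (t, _) => Sum.inr t

/-- **The first factor `x_{u_s}`** of the term `s` (always a basic variable): for
`F̄_{(123),(k+1)ab}` the terms are `-x_{𝔪∖k₁,a} x_{𝔪∖k₀,b}` and `+x_{𝔪∖k₀,a} x_{𝔪∖k₁,b}` with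
`{k₀ < k₁} = {0,1,2} ∖ {k}`; for `F̄_{(123),abc}` they are `-x_{12a}x_{3bc} + x_{13a}x_{2bc} - x_{23a}x_{1bc}`.
[cite: Hu2025, §3.5 (3.5)] -/
def fst : HuTerm m → HuVar m
  | Sum.inl (k, p, j) => HuVar.basic (HuVar.framePair k (![1, 0] j)) p.1.1
  | Sum.inr (t, j) => HuVar.basic j.rev t.1.1

/-- **The second factor `x_{v_s}`** of the term `s` (basic for rank 0, a rank-0 leading variable
for rank 1). [cite: Hu2025, §3.5 (3.5)] -/
def snd : HuTerm m → HuVar m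
  | Sum.inl (k, p, j) => HuVar.basic (HuVar.framePair k j) p.1.2
  | Sum.inr (t, j) => HuVar.rk0 j.rev ⟨t.1.2, t.2.2⟩

/-- **The sign `sgn(s) = ±1`** of the term `s` in (3.5). [cite: Hu2025, §3.3 (3.3') and §3.5 (3.5)] -/
def sign : HuTerm m → ℤ
  | Sum.inl (_, _, j) => ![-1, 1] j
  | Sum.inr (_, j) => ![-1, 1, -1] j

/-- `sgn(s) ∈ {1, -1}`. [folklore] -/
theorem sign_eq_one_or_eq_neg_one (s : HuTerm m) : s.sign = 1 ∨ s.sign = -1 := by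
  rcases s with ⟨k, p, j⟩ | ⟨t, j⟩
  · fin_cases j <;> simp [sign]
  · fin_cases j <;> simp [sign]

/-- The relation of a rank-0 term. [folklore] -/
@[simp] theorem rel_inl (k : Fin 3) (p : HuPair m) (j : Fin 2) :
    rel (Sum.inl (k, p, j) : HuTerm m) = Sum.inl (k, p) := rfl

/-- The relation of a rank-1 term. [folklore] -/
@[simp] theorem rel_inr (t : HuTripleIdx m) (j : Fin 3) :
    rel (Sum.inr (t, j) : HuTerm m) = Sum.inr t := rfl

end HuTerm

section Terms

variable (R : Type u) [CommRing R] (m : ℕ)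

/-- **The term `sgn(s) x_{u_s} x_{v_s}`** of `F̄` as a polynomial in Hu's variables. [cite: Hu2025, §3.5 (3.5)] -/
def termPoly (s : HuTerm m) : MvPolynomial (HuVar m) R :=
  C (s.sign : R) * (X s.fst * X s.snd)

/-- **(3.5) re-assembled from its terms, rank 0**: `F̄_{(123),(k+1)ab} = x_{(k+1)ab} + Σ_{j} sgn x_u x_v`.
[cite: Hu2025, §3.5 (3.5)] -/
theorem primaryRel_eq_rank0 (k : Fin 3) (p : HuPair m) :
    primaryRel R m (Sum.inl (k, p)) =
      X (HuVar.rk0 k p) + ∑ j : Fin 2, termPoly R m (Sum.inl (k, p, j)) := by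
  fin_cases k
  · simp [primaryRel, termPoly, HuTerm.sign, HuTerm.fst, HuTerm.snd, HuVar.framePair,
      Fin.sum_univ_two]
    ring
  · simp [primaryRel, termPoly, HuTerm.sign, HuTerm.fst, HuTerm.snd, HuVar.framePair,
      Fin.sum_univ_two]
    ring
  · simp [primaryRel, termPoly, HuTerm.sign, HuTerm.fst, HuTerm.snd, HuVar.framePair,
      Fin.sum_univ_two]
    ring

/-- **(3.5) re-assembled from its terms, rank 1**: `F̄_{(123),abc} = x_{abc} + Σ_{j} sgn x_u x_v`.
[cite: Hu2025, §3.5 (3.5)] -/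
theorem primaryRel_eq_rank1 (t : HuTripleIdx m) :
    primaryRel R m (Sum.inr t) = X (HuVar.rk1 t) + ∑ j : Fin 3, termPoly R m (Sum.inr (t, j)) := by
  simp [primaryRel, termPoly, HuTerm.sign, HuTerm.fst, HuTerm.snd, Fin.sum_univ_three,
    Fin.rev]
  ring

end Terms

/-! ### The `𝔯`-variables, Hu's ring `R = R₀[x_{(u,v)}]` and `φ` -/

/-- **The `𝔯`-variables** (homogeneous coordinates of the `ℙ_F`, §4.1): the leading one
`x_{(𝔪,u_F)}` of each relation (Def. 4.47) and `x_{(u_s,v_s)}` for each non-leading term.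
[cite: Hu2025, §4.1 Def. 4.1 and Def. 4.47] -/
abbrev HuRVar (m : ℕ) : Type := LeadVar m ⊕ HuTerm m

/-- The leading `𝔯`-variable `x_{(𝔪,u_F)}`. [cite: Hu2025, Def. 4.47] -/
abbrev HuRVar.rlead {m : ℕ} (F : LeadVar m) : HuVar m ⊕ HuRVar m := Sum.inr (Sum.inl F)

/-- The `𝔯`-variable `x_{(u_s,v_s)}` of a non-leading term. [cite: Hu2025, §4.1 Def. 4.1] -/
abbrev HuRVar.rterm {m : ℕ} (s : HuTerm m) : HuVar m ⊕ HuRVar m := Sum.inr (Sum.inr s)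

/-- The `𝔭`-variable `x_u` inside Hu's big ring. [cite: Hu2025, §4.1 Def. 4.1] -/
abbrev HuRVar.pvar {m : ℕ} (v : HuVar m) : HuVar m ⊕ HuRVar m := Sum.inl v

section Phi

variable (R : Type u) [CommRing R] (m : ℕ)

/-- **Hu's ring `R = R₀[x_{(u_s,v_s)}]`** (Def. 4.2), `R₀ = R[x_u : u ∈ I_{3,n} ∖ (123)]`: the
multi-homogeneous coordinate ring of `𝓡 = 𝕌 × ∏_F ℙ_F`. [cite: Hu2025, §4.1 Def. 4.2] -/
abbrev HuRing : Type u := MvPolynomial (HuVar m ⊕ HuRVar m) R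

/-- **`φ : R → R₀`**, the identity on `R₀` and `x_{(u_s,v_s)} ↦ x_{u_s} x_{v_s}`,
`x_{(𝔪,u_F)} ↦ x_𝔪 x_{u_F} = x_{u_F}` (`x_𝔪 = x_{123} = 1` on the chart).
[cite: Hu2025, §4.1 Def. 4.2 (4.4)] -/
def huPhi : HuRing R m →ₐ[R] MvPolynomial (HuVar m) R :=
  aeval (Sum.elim X (Sum.elim (fun F => X (Sum.inr F)) fun s => X s.fst * X s.snd))

/-- `φ` is the identity on the `𝔭`-variables. [cite: Hu2025, §4.1 Def. 4.2] -/
@[simp] theorem huPhi_X_pvar (v : HuVar m) : huPhi R m (X (HuRVar.pvar v)) = X v := by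
  simp [huPhi]

/-- `φ(x_{(𝔪,u_F)}) = x_{u_F}`. [cite: Hu2025, §4.1 Def. 4.2] -/
@[simp] theorem huPhi_X_rlead (F : LeadVar m) : huPhi R m (X (HuRVar.rlead F)) = X (Sum.inr F) := by
  simp [huPhi]

/-- `φ(x_{(u_s,v_s)}) = x_{u_s} x_{v_s}`. [cite: Hu2025, §4.1 Def. 4.2] -/
@[simp] theorem huPhi_X_rterm (s : HuTerm m) :
    huPhi R m (X (HuRVar.rterm s)) = X s.fst * X s.snd := by
  simp [huPhi]

/-! ### Governing and non-governing binomials, linearized Plücker relations -/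

/-- **The governing binomial `B_{F,s} = x_{(u_s,v_s)} x_{u_F} - x_{(𝔪,u_F)} x_{u_s} x_{v_s}`**,
`s ∈ S_F ∖ s_F` (plus-term `T⁺ = x_{(u_s,v_s)} x_{u_F}`, minus-term
`T⁻ = x_{(𝔪,u_F)} x_{u_s} x_{v_s}`, Def. 5.8). [cite: Hu2025, Def. 4.49 (4.34) and §5.2 Def. 5.8] -/
def govBinomial (s : HuTerm m) : HuRing R m :=
  X (HuRVar.rterm s) * X (HuRVar.pvar (Sum.inr s.rel)) -
    X (HuRVar.rlead s.rel) * X (HuRVar.pvar s.fst) * X (HuRVar.pvar s.snd)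

/-- **The non-governing binomial
`B_{F,(s,t)} = x_{(u_s,v_s)} x_{u_t} x_{v_t} - x_{(u_t,v_t)} x_{u_s} x_{v_s}`**, `s, t ∈ S_F ∖ s_F`
(a `℘`-binomial (4.30)). [cite: Hu2025, Def. 4.49 (4.35) and (4.30); Lemma 7.3] -/
def ngvBinomial (s t : HuTerm m) : HuRing R m :=
  X (HuRVar.rterm s) * X (HuRVar.pvar t.fst) * X (HuRVar.pvar t.snd) -
    X (HuRVar.rterm t) * X (HuRVar.pvar s.fst) * X (HuRVar.pvar s.snd)

/-- **The linearized Plücker relation `L_F = x_{(𝔪,u_F)} + Σ_{s ∈ S_F ∖ s_F} sgn(s) x_{(u_s,v_s)}`**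
(the leading term has sign `+`, (3.5)). [cite: Hu2025, §4.4 (4.27) and §2.4 (2.14)] -/
def linPl : LeadVar m → HuRing R m
  | Sum.inl (k, p) =>
    X (HuRVar.rlead (Sum.inl (k, p))) +
      ∑ j : Fin 2, C (HuTerm.sign (Sum.inl (k, p, j) : HuTerm m) : R) * X (HuRVar.rterm (Sum.inl (k, p, j)))
  | Sum.inr t =>
    X (HuRVar.rlead (Sum.inr t)) +
      ∑ j : Fin 3, C (HuTerm.sign (Sum.inr (t, j) : HuTerm m) : R) * X (HuRVar.rterm (Sum.inr (t, j)))

/-- **`B_{F,s} ∈ ker φ`** (Lemma 4.4: the `℘`-binomials lie in the multi-homogeneous kernel).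
[cite: Hu2025, §4.2 Lemma 4.4] -/
@[simp] theorem huPhi_govBinomial (s : HuTerm m) : huPhi R m (govBinomial R m s) = 0 := by
  simp only [govBinomial, map_sub, map_mul, huPhi_X_rterm, huPhi_X_pvar, huPhi_X_rlead]
  ring

/-- **`B_{F,(s,t)} ∈ ker φ`**. [cite: Hu2025, §4.2 Lemma 4.4] -/
@[simp] theorem huPhi_ngvBinomial (s t : HuTerm m) : huPhi R m (ngvBinomial R m s t) = 0 := by
  simp only [ngvBinomial, map_sub, map_mul, huPhi_X_rterm, huPhi_X_pvar]
  ring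

/-- **`φ(L_F) = F̄`**: the linearized relation descends to the primary Plücker relation.
[cite: Hu2025, §4.4 (4.27)–(4.28)] -/
theorem huPhi_linPl (F : LeadVar m) : huPhi R m (linPl R m F) = primaryRel R m F := by
  rcases F with ⟨k, p⟩ | t
  · rw [primaryRel_eq_rank0]
    simp [linPl, termPoly]
  · rw [primaryRel_eq_rank1]
    simp [linPl, termPoly]

/-- Hence `L_F` dies on the graph of the `[I₃ | A]` model: `(x_u ↦ minor_u) (φ(L_F)) = 0` — with
`huPhi_govBinomial` and `huPhi_ngvBinomial`, the containment `𝒱 ⊆ V(𝓑^gov, 𝓑^ngv, L_𝓕)` of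
Cor. 4.46 at the level of coordinate rings. [cite: Hu2025, Cor. 4.46] -/
theorem plEval_huPhi_linPl (F : LeadVar m) : plEval R m (huPhi R m (linPl R m F)) = 0 := by
  rw [huPhi_linPl, plEval_primaryRel]

/-- **The reduction (4.33): `x_{(𝔪,u_F)} · F̄ - x_{u_F} · L_F = - Σ_{s ∈ S_F ∖ s_F} sgn(s) B_{F,s}`**,
rank 0 ("by multiplying `sgn(s)` to the `℘`-binomials and adding them all together, we obtain
`x_{(u,v)} F̄_i = x_u x_v L_{F_i} mod 𝓑^℘`", here for `(u,v) = (𝔪, u_F)`, `x_𝔪 = 1`).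
[cite: Hu2025, §4.4 (4.32)–(4.33)] -/
theorem X_rlead_mul_primaryRel_sub_rank0 (k : Fin 3) (p : HuPair m) :
    X (HuRVar.rlead (Sum.inl (k, p))) * rename Sum.inl (primaryRel R m (Sum.inl (k, p))) -
        X (HuRVar.pvar (HuVar.rk0 k p)) * linPl R m (Sum.inl (k, p)) =
      -∑ j : Fin 2, C (HuTerm.sign (Sum.inl (k, p, j) : HuTerm m) : R) * govBinomial R m (Sum.inl (k, p, j)) := by
  rw [primaryRel_eq_rank0]
  simp only [linPl, govBinomial, termPoly, map_add, map_mul, rename_X, rename_C,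
    Fin.sum_univ_two, HuTerm.rel_inl]
  ring

/-- **The reduction (4.33), rank 1.** [cite: Hu2025, §4.4 (4.32)–(4.33)] -/
theorem X_rlead_mul_primaryRel_sub_rank1 (t : HuTripleIdx m) :
    X (HuRVar.rlead (Sum.inr t)) * rename Sum.inl (primaryRel R m (Sum.inr t)) -
        X (HuRVar.pvar (HuVar.rk1 t)) * linPl R m (Sum.inr t) =
      -∑ j : Fin 3, C (HuTerm.sign (Sum.inr (t, j) : HuTerm m) : R) * govBinomial R m (Sum.inr (t, j)) := by
  rw [primaryRel_eq_rank1]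
  simp only [linPl, govBinomial, termPoly, map_add, map_mul, rename_X, rename_C,
    Fin.sum_univ_three, HuTerm.rel_inr]
  ring

/-- **The ideal of the block `𝔊_F` of governing binomials of `F`** (Def. 4.51, without `L_F`).
[cite: Hu2025, Def. 4.49 and Def. 4.51] -/
def govIdeal (F : LeadVar m) : Ideal (HuRing R m) :=
  Ideal.span (govBinomial R m '' {s | s.rel = F})

/-- `x_{(𝔪,u_F)} F̄ - x_{u_F} L_F` lies in the ideal of the governing binomials of `F`
("`F̄_i` depends on `L_{F_i}` modulo `𝓑^℘`"). [cite: Hu2025, §4.4 Lemma 4.45 (3) and (4.33)] -/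
theorem X_rlead_mul_primaryRel_sub_mem (F : LeadVar m) :
    X (HuRVar.rlead F) * rename Sum.inl (primaryRel R m F) - X (HuRVar.pvar (Sum.inr F)) * linPl R m F ∈
      govIdeal R m F := by
  rcases F with ⟨k, p⟩ | t
  · rw [show (HuRVar.pvar (Sum.inr (Sum.inl (k, p))) : HuVar m ⊕ HuRVar m) =
        HuRVar.pvar (HuVar.rk0 k p) from rfl, X_rlead_mul_primaryRel_sub_rank0, neg_mem_iff]
    exact Ideal.sum_mem _ fun j _ => Ideal.mul_mem_left _ _
      (Ideal.subset_span ⟨Sum.inl (k, p, j), rfl, rfl⟩)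
  · rw [show (HuRVar.pvar (Sum.inr (Sum.inr t)) : HuVar m ⊕ HuRVar m) = HuRVar.pvar (HuVar.rk1 t)
        from rfl, X_rlead_mul_primaryRel_sub_rank1, neg_mem_iff]
    exact Ideal.sum_mem _ fun j _ => Ideal.mul_mem_left _ _
      (Ideal.subset_span ⟨Sum.inr (t, j), rfl, rfl⟩)

end Phi

end Literature.AlgebraicGeometry.Resolution

end
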